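import Mathlib.Analysis.Complex.Polynomial.Basic
import Mathlib.RingTheory.MvPolynomial.Homogeneous
import Literature.Computability.Complexity.SumOfSquaresRefutation
import Literature.FieldTheory.QuasiAlgClosed.Basic
import Literature.RingTheory.Nullstellensatz.PerronTheorem
import HarnessLib

/-!
# Real and imaginary parts of complex polynomials: algebra and degrees of the realification

Companion lemmas to `SumOfSquaresRefutation.lean` (`reCoeff`, `imCoeff`, `realifyVars`,
`realifySystem`), used to identify Hermitian sums-of-squares refutations of a complex system with
static Positivstellensatz refutations of its realification (`HermitianSosRealification.lean`,
definition request `defn-HasHermitianSosRefutationOfDegree`, optional item (3): "equivalence, with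
the same degree, to a real Positivstellensatz refutation of the realification").

## Contents (theorems only)

* Coefficientwise algebra of `Re`, `Im` on `ℂ[τ]`: `reCoeff`/`imCoeff` of `ofReal A + i · ofReal B`,
  `P + conj P = ofReal (2 Re P)` (`add_map_conj`), `Q · conj Q = ofReal ((Re Q)² + (Im Q)²)`
  (`mul_map_conj`), the product rule `Re (P Q) = Re P Re Q - Im P Im Q` (`reCoeff_mul`), and the
  degree bounds `deg Re Q, deg Im Q ≤ deg Q`.
* `realifyVars` (the substitution `z_s ↦ u_s + i v_s`) does not raise total degree and preserves
  homogeneity; `Re (P (z)) = (Re P̂)(Re z, Im z)` (`re_eval_eq_eval_reCoeff`).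
* THE DEGREE LEMMA `totalDegree_le_totalDegree_reCoeff_realifyVars`:
  `deg g ≤ deg Re ĝ` and `deg g ≤ deg Im ĝ` for EVERY `g ∈ ℂ[σ]` (`ĝ = realifyVars g`): the top
  homogeneous component `g_e`, `e ≥ 1`, cannot have identically vanishing real (or imaginary) part,
  since `g_e (ζ z) = ζ^e g_e (z)` with `ζ^e = i` turns real parts into imaginary parts and a form
  vanishing on `ℂ^σ` is zero. Hence `deg ĝ = deg g` (`totalDegree_realifyVars`) and every nonzero
  equation of the realified system has the degree of the complex equation it comes from
  (`totalDegree_realifySystem`). This is what makes the degree of a real Positivstellensatz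
  refutation of the realification match the Hermitian degree.

Mathlib: `IsAlgClosed.exists_pow_nat_eq` (roots of `i`), `MvPolynomial.IsHomogeneous.aeval`,
`IsHomogeneous.eq_zero_of_forall_eval_eq_zero`, `homogeneousComponent`; Literature:
`MvPolynomial.IsHomogeneous.eval_smul_eq` (QuasiAlgClosed/Basic), `totalDegree_aeval_le`
(Nullstellensatz/PerronTheorem).

## References

* D. Grigoriev, *Complexity of Positivstellensatz proofs for the knapsack*, Comput. Complexity 10
  (2001) 139–154, Def. 0.5 (degree of static Positivstellensatz refutations). [Grigoriev2001]
-/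

noncomputable section

open MvPolynomial Finset
open scoped ComplexConjugate

namespace Literature.Computability.Complexity

/-! ### Coefficientwise algebra of real and imaginary parts -/

section RealParts

variable {τ : Type*}

/-- `Re 0 = 0`. [folklore] -/
@[simp] theorem reCoeff_zero : reCoeff (0 : MvPolynomial τ ℂ) = 0 := by
  ext n; simp

/-- `Im 0 = 0`. [folklore] -/
@[simp] theorem imCoeff_zero : imCoeff (0 : MvPolynomial τ ℂ) = 0 := by
  ext n; simp

/-- `deg Re Q ≤ deg Q` (the support can only shrink). [folklore] -/
theorem totalDegree_reCoeff_le (Q : MvPolynomial τ ℂ) : (reCoeff Q).totalDegree ≤ Q.totalDegree := by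
  rw [totalDegree, totalDegree]
  refine Finset.sup_mono fun n hn => ?_
  rw [mem_support_iff] at hn ⊢
  intro h
  apply hn
  rw [coeff_reCoeff, h, Complex.zero_re]

/-- `deg Im Q ≤ deg Q`. [folklore] -/
theorem totalDegree_imCoeff_le (Q : MvPolynomial τ ℂ) : (imCoeff Q).totalDegree ≤ Q.totalDegree := by
  rw [totalDegree, totalDegree]
  refine Finset.sup_mono fun n hn => ?_
  rw [mem_support_iff] at hn ⊢
  intro h
  apply hn
  rw [coeff_imCoeff, h, Complex.zero_im]

/-- `deg (ofReal A) ≤ deg A`. [folklore] -/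
theorem totalDegree_map_ofRealHom_le (A : MvPolynomial τ ℝ) :
    (map Complex.ofRealHom A).totalDegree ≤ A.totalDegree := by
  rw [totalDegree, totalDegree]
  exact Finset.sup_mono (support_map_subset _ _)

/-- Complex conjugation of the coefficients fixes real polynomials. [folklore] -/
theorem map_conj_map_ofRealHom (A : MvPolynomial τ ℝ) :
    map (starRingEnd ℂ) (map Complex.ofRealHom A) = map Complex.ofRealHom A := by
  have h : (starRingEnd ℂ).comp Complex.ofRealHom = Complex.ofRealHom :=
    RingHom.ext fun x => Complex.conj_ofReal x
  rw [MvPolynomial.map_map, h]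

/-- `Re (A + i B) = A` for real `A`, `B`. [folklore] -/
@[simp] theorem reCoeff_ofReal_add_I_mul (A B : MvPolynomial τ ℝ) :
    reCoeff (map Complex.ofRealHom A + C Complex.I * map Complex.ofRealHom B) = A := by
  ext n
  simp [coeff_reCoeff, coeff_map, coeff_C_mul]

/-- `Im (A + i B) = B` for real `A`, `B`. [folklore] -/
@[simp] theorem imCoeff_ofReal_add_I_mul (A B : MvPolynomial τ ℝ) :
    imCoeff (map Complex.ofRealHom A + C Complex.I * map Complex.ofRealHom B) = B := by
  ext n
  simp [coeff_imCoeff, coeff_map, coeff_C_mul]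

/-- `Re (ofReal A) = A`. [folklore] -/
@[simp] theorem reCoeff_map_ofRealHom (A : MvPolynomial τ ℝ) :
    reCoeff (map Complex.ofRealHom A) = A := by
  ext n
  simp [coeff_reCoeff, coeff_map]

/-- `Im (ofReal A) = 0`. [folklore] -/
@[simp] theorem imCoeff_map_ofRealHom (A : MvPolynomial τ ℝ) :
    imCoeff (map Complex.ofRealHom A) = 0 := by
  ext n
  simp [coeff_imCoeff, coeff_map]

/-- `P + conj P = 2 Re P` (as complex polynomials). [folklore] -/
theorem add_map_conj (P : MvPolynomial τ ℂ) :
    P + map (starRingEnd ℂ) P = map Complex.ofRealHom (C 2 * reCoeff P) := by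
  ext n
  simp only [coeff_add, coeff_map, coeff_C_mul, coeff_reCoeff, Complex.ofRealHom_eq_coe]
  apply Complex.ext
  · simp; ring
  · simp

/-- `i · i = -1` on the level of constant polynomials. [folklore] -/
theorem C_I_mul_C_I : (C Complex.I : MvPolynomial τ ℂ) * C Complex.I = -1 := by
  rw [← C_mul, Complex.I_mul_I, C_neg, C_1]

/-- Multiplication in real and imaginary parts:
`(A + iB)(A' + iB') = (AA' - BB') + i (AB' + BA')`. [folklore] -/
theorem ofReal_add_I_mul_mul (A B A' B' : MvPolynomial τ ℝ) :
    (map Complex.ofRealHom A + C Complex.I * map Complex.ofRealHom B) *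
        (map Complex.ofRealHom A' + C Complex.I * map Complex.ofRealHom B') =
      map Complex.ofRealHom (A * A' - B * B') +
        C Complex.I * map Complex.ofRealHom (A * B' + B * A') := by
  simp only [map_sub, map_add, map_mul]
  linear_combination (map Complex.ofRealHom B * map Complex.ofRealHom B') * (C_I_mul_C_I (τ := τ))

/-- Product rule for real parts: `Re (P Q) = Re P · Re Q - Im P · Im Q`. [folklore] -/
theorem reCoeff_mul (P Q : MvPolynomial τ ℂ) :
    reCoeff (P * Q) = reCoeff P * reCoeff Q - imCoeff P * imCoeff Q := by
  conv_lhs => rw [← map_reCoeff_add_imCoeff P, ← map_reCoeff_add_imCoeff Q, ofReal_add_I_mul_mul]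
  exact reCoeff_ofReal_add_I_mul _ _

/-- Product rule for imaginary parts: `Im (P Q) = Re P · Im Q + Im P · Re Q`. [folklore] -/
theorem imCoeff_mul (P Q : MvPolynomial τ ℂ) :
    imCoeff (P * Q) = reCoeff P * imCoeff Q + imCoeff P * reCoeff Q := by
  conv_lhs => rw [← map_reCoeff_add_imCoeff P, ← map_reCoeff_add_imCoeff Q, ofReal_add_I_mul_mul]
  exact imCoeff_ofReal_add_I_mul _ _

/-- `Q · conj Q = (Re Q)² + (Im Q)²`: a Hermitian square is a sum of two real squares. [folklore] -/
theorem mul_map_conj (Q : MvPolynomial τ ℂ) :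
    Q * map (starRingEnd ℂ) Q =
      map Complex.ofRealHom (reCoeff Q * reCoeff Q + imCoeff Q * imCoeff Q) := by
  conv_lhs => rw [← map_reCoeff_add_imCoeff Q]
  rw [map_add (map (starRingEnd ℂ)), map_mul (map (starRingEnd ℂ)), map_C, map_conj_map_ofRealHom,
    map_conj_map_ofRealHom, Complex.conj_I, C_neg]
  simp only [map_add, map_mul]
  linear_combination (-(map Complex.ofRealHom (imCoeff Q) * map Complex.ofRealHom (imCoeff Q))) *
    (C_I_mul_C_I (τ := τ))

end RealParts

/-! ### Degrees and homogeneity under realification -/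

section RealifyDegree

variable {σ : Type*}

/-- `realifyVars` is the substitution `z_s ↦ u_s + i v_s` (definitional unfolding). [folklore] -/
theorem realifyVars_eq_aeval (g : MvPolynomial σ ℂ) :
    realifyVars g = aeval (fun s : σ =>
      (X (s, false) + C Complex.I * X (s, true) : MvPolynomial (σ × Bool) ℂ)) g := rfl

/-- The linear forms `u_s + i v_s` have degree `≤ 1`. [folklore] -/
theorem totalDegree_X_add_C_mul_X_le {τ : Type*} (a b : τ) (c : ℂ) :
    (X a + C c * X b : MvPolynomial τ ℂ).totalDegree ≤ 1 :=
  (totalDegree_add _ _).trans (max_le (totalDegree_X (R := ℂ) a).le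
    ((totalDegree_mul _ _).trans (by rw [totalDegree_C, totalDegree_X, zero_add])))

/-- Realification does not raise the total degree. [folklore] -/
theorem totalDegree_realifyVars_le (g : MvPolynomial σ ℂ) :
    (realifyVars g).totalDegree ≤ g.totalDegree := by
  have h := Literature.RingTheory.Nullstellensatz.totalDegree_aeval_le
    (fun s : σ => (X (s, false) + C Complex.I * X (s, true) : MvPolynomial (σ × Bool) ℂ)) (δ := 1)
    (fun s => totalDegree_X_add_C_mul_X_le _ _ _) g
  rw [mul_one] at h
  exact h

/-- Realification of a form of degree `n` is a form of degree `n`. [folklore] -/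
theorem isHomogeneous_realifyVars {g : MvPolynomial σ ℂ} {n : ℕ} (hg : g.IsHomogeneous n) :
    (realifyVars g).IsHomogeneous n := by
  have h := hg.aeval (fun s : σ => (X (s, false) + C Complex.I * X (s, true) :
      MvPolynomial (σ × Bool) ℂ))
    (fun s => (isHomogeneous_X ℂ (s, false)).add (isHomogeneous_C_mul_X Complex.I (s, true)))
  rw [one_mul] at h
  exact h

/-- `Re (P(z)) = (Re P̂)(Re z, Im z)`. [folklore] -/
theorem re_eval_eq_eval_reCoeff (P : MvPolynomial σ ℂ) (z : σ → ℂ) :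
    (eval z P).re = eval (realCoords z) (reCoeff (realifyVars P)) := by
  rw [eval_eq_realify]
  simp [realify]

/-- `Im (P(z)) = (Im P̂)(Re z, Im z)`. [folklore] -/
theorem im_eval_eq_eval_imCoeff (P : MvPolynomial σ ℂ) (z : σ → ℂ) :
    (eval z P).im = eval (realCoords z) (imCoeff (realifyVars P)) := by
  rw [eval_eq_realify]
  simp [realify]

/-- A complex form of positive degree whose values are all purely imaginary is zero: with
`ζ^e = i`, `G(ζ z) = i G(z)` has real part `-Im G(z)`. [folklore] -/
theorem eq_zero_of_isHomogeneous_of_re_eval_eq_zero {G : MvPolynomial σ ℂ} {e : ℕ}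
    (hG : G.IsHomogeneous e) (he : 0 < e) (h : ∀ z : σ → ℂ, (eval z G).re = 0) : G = 0 := by
  obtain ⟨ζ, hζ⟩ := IsAlgClosed.exists_pow_nat_eq Complex.I he
  refine hG.eq_zero_of_forall_eval_eq_zero fun z => ?_
  have h1 := h z
  have h2 := h (ζ • z)
  rw [hG.eval_smul_eq, hζ, Complex.mul_re, Complex.I_re, Complex.I_im, zero_mul, one_mul,
    zero_sub, neg_eq_zero] at h2
  exact Complex.ext h1 h2

/-- A complex form of positive degree whose values are all real is zero. [folklore] -/
theorem eq_zero_of_isHomogeneous_of_im_eval_eq_zero {G : MvPolynomial σ ℂ} {e : ℕ}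
    (hG : G.IsHomogeneous e) (he : 0 < e) (h : ∀ z : σ → ℂ, (eval z G).im = 0) : G = 0 := by
  have hIG : C Complex.I * G = 0 :=
    eq_zero_of_isHomogeneous_of_re_eval_eq_zero (hG.C_mul Complex.I) he fun z => by
      rw [map_mul, eval_C, Complex.mul_re, h z, Complex.I_re, zero_mul, mul_zero, sub_zero]
  simpa [Complex.I_ne_zero] using hIG

/-- The engine of the degree lemma, uniform in the part (`Re` or `Im`) taken. [folklore] -/
private theorem totalDegree_le_totalDegree_part_realifyVars (π : ℂ → ℝ) (hπ : π 0 = 0)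
    (part : MvPolynomial (σ × Bool) ℂ → MvPolynomial (σ × Bool) ℝ)
    (hcoeff : ∀ (P : MvPolynomial (σ × Bool) ℂ) n, coeff n (part P) = π (coeff n P))
    (heval : ∀ (P : MvPolynomial σ ℂ) (z : σ → ℂ),
      π (eval z P) = eval (realCoords z) (part (realifyVars P)))
    (hvanish : ∀ (G : MvPolynomial σ ℂ) (e : ℕ), G.IsHomogeneous e → 0 < e →
      (∀ z : σ → ℂ, π (eval z G) = 0) → G = 0)
    (g : MvPolynomial σ ℂ) : g.totalDegree ≤ (part (realifyVars g)).totalDegree := by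
  classical
  set e := g.totalDegree with he_def
  rcases Nat.eq_zero_or_pos e with he | he
  · rw [he]; exact Nat.zero_le _
  -- the top homogeneous component is nonzero
  set G := homogeneousComponent e g with hG_def
  have hGhom : G.IsHomogeneous e := homogeneousComponent_isHomogeneous e g
  have hg0 : g ≠ 0 := by
    rintro rfl
    rw [he_def, totalDegree_zero] at he
    exact lt_irrefl 0 he
  have hG0 : G ≠ 0 := by
    obtain ⟨s, hs, hsdeg⟩ := Finset.exists_mem_eq_sup g.support (support_nonempty.mpr hg0)
      (fun s : (σ →₀ ℕ) => s.sum fun _ m => m)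
    intro hG
    have hc := congrArg (coeff s) hG
    rw [hG_def, coeff_homogeneousComponent, if_pos, coeff_zero] at hc
    · exact (mem_support_iff.mp hs) hc
    · rw [he_def, totalDegree, hsdeg]; rfl
  -- its `part` does not vanish identically
  have hpart : part (realifyVars G) ≠ 0 := by
    intro h0
    exact hG0 (hvanish G e hGhom he fun z => by rw [heval, h0, map_zero])
  obtain ⟨n, hn⟩ := exists_coeff_ne_zero hpart
  have hn' : coeff n (realifyVars G) ≠ 0 := fun h => hn (by rw [hcoeff, h, hπ])
  have hndeg : n.degree = e := by
    have := isHomogeneous_realifyVars hGhom hn'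
    rw [← this, Finsupp.degree_eq_weight_one]
    rfl
  -- the same coefficient of `part (realifyVars g)` is nonzero
  have hcoeffg : coeff n (part (realifyVars g)) = coeff n (part (realifyVars G)) := by
    rw [hcoeff, hcoeff]
    congr 1
    conv_lhs => rw [← sum_homogeneousComponent g, map_sum, coeff_sum]
    rw [Finset.sum_eq_single e]
    · intro i _ hi
      exact (isHomogeneous_realifyVars (homogeneousComponent_isHomogeneous i g)).coeff_eq_zero
        (by rw [hndeg]; exact Ne.symm hi)
    · intro h
      exact absurd (Finset.mem_range.mpr (Nat.lt_succ_self _)) h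
  have hmem : n ∈ (part (realifyVars g)).support := by
    rw [mem_support_iff, hcoeffg]; exact hn
  calc e = n.degree := hndeg.symm
    _ ≤ _ := by
        have := le_totalDegree hmem
        rwa [Finsupp.degree]

/-- **Degree lemma, real part**: `deg g ≤ deg Re(ĝ)`, `ĝ = realifyVars g` — the top form of `g`
has non-vanishing real part. [folklore] -/
theorem totalDegree_le_totalDegree_reCoeff_realifyVars (g : MvPolynomial σ ℂ) :
    g.totalDegree ≤ (reCoeff (realifyVars g)).totalDegree :=
  totalDegree_le_totalDegree_part_realifyVars Complex.re Complex.zero_re reCoeff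
    (fun P n => coeff_reCoeff P n) re_eval_eq_eval_reCoeff
    (fun _ _ hG he h => eq_zero_of_isHomogeneous_of_re_eval_eq_zero hG he h) g

/-- **Degree lemma, imaginary part**: `deg g ≤ deg Im(ĝ)`. [folklore] -/
theorem totalDegree_le_totalDegree_imCoeff_realifyVars (g : MvPolynomial σ ℂ) :
    g.totalDegree ≤ (imCoeff (realifyVars g)).totalDegree :=
  totalDegree_le_totalDegree_part_realifyVars Complex.im Complex.zero_im imCoeff
    (fun P n => coeff_imCoeff P n) im_eval_eq_eval_imCoeff
    (fun _ _ hG he h => eq_zero_of_isHomogeneous_of_im_eval_eq_zero hG he h) g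

/-- Realification preserves the total degree exactly. [folklore] -/
theorem totalDegree_realifyVars (g : MvPolynomial σ ℂ) :
    (realifyVars g).totalDegree = g.totalDegree :=
  le_antisymm (totalDegree_realifyVars_le g)
    ((totalDegree_le_totalDegree_reCoeff_realifyVars g).trans (totalDegree_reCoeff_le _))

/-- `deg Re(ĝ) = deg g`. [folklore] -/
theorem totalDegree_reCoeff_realifyVars (g : MvPolynomial σ ℂ) :
    (reCoeff (realifyVars g)).totalDegree = g.totalDegree :=
  le_antisymm ((totalDegree_reCoeff_le _).trans (totalDegree_realifyVars_le g))
    (totalDegree_le_totalDegree_reCoeff_realifyVars g)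

/-- `deg Im(ĝ) = deg g`. [folklore] -/
theorem totalDegree_imCoeff_realifyVars (g : MvPolynomial σ ℂ) :
    (imCoeff (realifyVars g)).totalDegree = g.totalDegree :=
  le_antisymm ((totalDegree_imCoeff_le _).trans (totalDegree_realifyVars_le g))
    (totalDegree_le_totalDegree_imCoeff_realifyVars g)

/-- The equations of the realified system, unfolded: real parts at `false`, imaginary parts at
`true`. [folklore] -/
theorem realifySystem_apply {ι : Type*} (S : ι → MvPolynomial σ ℂ) (e : ι × Bool) :
    realifySystem S e =
      if e.2 then imCoeff (realifyVars (S e.1)) else reCoeff (realifyVars (S e.1)) := rfl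

/-- Every equation of the realified system has exactly the degree of the complex equation it
comes from. [folklore] -/
theorem totalDegree_realifySystem {ι : Type*} (S : ι → MvPolynomial σ ℂ) (e : ι × Bool) :
    (realifySystem S e).totalDegree = (S e.1).totalDegree := by
  rw [realifySystem_apply]
  split_ifs
  · exact totalDegree_imCoeff_realifyVars _
  · exact totalDegree_reCoeff_realifyVars _

end RealifyDegree

end Literature.Computability.Complexity

end
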